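import Summits.Parity.BatemanHorn.Theorems.SoloInformedPolyDifferences
import Literature.NumberTheory.Automorphic.LocalWeylLaw

/-!
# `∇² log|g(m)| ≪ 1/m²` and the support of the located weights in `m`

Informed soloist `solo-Parity-informed` (session 143), conjunct `BatemanHorn`, the `d ≥ 3` rung BELOW the parity
wall; sequel to `SoloInformedPolyDifferences`, second input file for the second-order Abel summation in `m` of the
trapezoid kernels.  For `g` irreducible of degree `d ≥ 2` and `Δ > 0`:

* `exists_abs_log_natAbs_second_diff_le`: `|log|g(m+2)| − 2 log|g(m+1)| + log|g(m)|| ≤ C_g/m²` (`m ≥ 1`), via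
  `g(m)g(m+2) − g(m+1)² = g(m)·∇²g(m) − (∇g(m))² ≪ m^{2d−2}` against `g(m+1)² ≫ m^{2d}` — so inside its ramp the
  located weight `a_e(m) = cl((Δ − log e + ½ log|g(m)|)/(2Δ))` has second `m`-differences `≪ 1/(Δm²)`;
* `exists_locWeight_eq_zero_of_pow_le` / `exists_locWeight_eq_one_of_le_pow` / `exists_locWeight_zero_eq_zero`:
  `a_e(m) = 0` whenever `m^d ≤ c_g·e²` (and at `m = 0` for `e ≥ e₀`), `a_e(m) = 1` whenever `C_g·e² ≤ m^d` — the
  weight of the modulus `e` ramps on `m ≍ e^{2/d}`.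
-/

namespace Summit.Parity.BatemanHorn.Theorems

open Finset Polynomial

/-- **`|log|g(m+2)| − 2 log|g(m+1)| + log|g(m)|| ≤ C_g/m²`** for `g` irreducible of degree `d ≥ 2`, all `m ≥ 1`
(`g(m)g(m+2) − g(m+1)² = g(m)·∇²g(m) − (∇g(m))² ≪ m^{2d−2}` against `g(m+1)² ≫ m^{2d}`). [this work] -/
theorem exists_abs_log_natAbs_second_diff_le {g : ℤ[X]} (hirr : Irreducible g) (hdeg : 2 ≤ g.natDegree) :
    ∃ C : ℝ, ∀ m : ℕ, 1 ≤ m →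
      |Real.log ((g.eval ((m : ℤ) + 2)).natAbs : ℝ) - 2 * Real.log ((g.eval ((m : ℤ) + 1)).natAbs : ℝ)
        + Real.log ((g.eval (m : ℤ)).natAbs : ℝ)| ≤ C / (m : ℝ) ^ 2 := by
  obtain ⟨B, hB⟩ := exists_abs_log_natAbs_eval_sub_le (g := g) (by omega)
  set d : ℕ := g.natDegree with hd
  set L : ℝ := coeffAbsSum g with hL
  have hL0 : 0 ≤ L := coeffAbsSum_nonneg g
  have hz : ∀ k : ℕ, g.eval (k : ℤ) ≠ 0 := fun k => eval_natCast_ne_zero_of_irreducible hirr hdeg k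
  -- notation: `G k = g(k)` as a real number, `N k = |g(k)|`
  set G : ℕ → ℝ := fun k => ((g.eval (k : ℤ) : ℤ) : ℝ) with hG
  have hGz : ∀ k, G k ≠ 0 := fun k => by simp only [hG]; exact_mod_cast hz k
  have hN : ∀ k : ℕ, ((g.eval (k : ℤ)).natAbs : ℝ) = |G k| := fun k => natCast_natAbs_eval g k
  have hNpos : ∀ k, 0 < |G k| := fun k => abs_pos.mpr (hGz k)
  -- two-sided size `e^{-B} k^d ≤ |g(k)| ≤ e^{B} k^d`
  have hlow : ∀ k : ℕ, 1 ≤ k → Real.exp (-B) * (k : ℝ) ^ d ≤ |G k| := by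
    intro k hk
    have hk0 : (0 : ℝ) < k := by exact_mod_cast hk
    have h1 := (abs_le.mp (hB k hk)).1
    rw [hN] at h1
    calc Real.exp (-B) * (k : ℝ) ^ d = Real.exp (-B + d * Real.log k) := by
          rw [Real.exp_add, ← Real.log_pow, Real.exp_log (pow_pos hk0 d)]
      _ ≤ Real.exp (Real.log |G k|) := Real.exp_le_exp.mpr (by rw [hd]; linarith)
      _ = |G k| := Real.exp_log (hNpos k)
  have hupp : ∀ k : ℕ, 1 ≤ k → |G k| ≤ Real.exp B * (k : ℝ) ^ d := by
    intro k hk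
    have hk0 : (0 : ℝ) < k := by exact_mod_cast hk
    have h1 := (abs_le.mp (hB k hk)).2
    rw [hN] at h1
    calc |G k| = Real.exp (Real.log |G k|) := (Real.exp_log (hNpos k)).symm
      _ ≤ Real.exp (B + d * Real.log k) := Real.exp_le_exp.mpr (by rw [hd]; linarith)
      _ = Real.exp B * (k : ℝ) ^ d := by rw [Real.exp_add, ← Real.log_pow, Real.exp_log (pow_pos hk0 d)]
  -- the constant
  set A : ℝ := (Real.exp B * ((d : ℝ) * d * L * 3 ^ (d - 2)) + ((d : ℝ) * L * 2 ^ (d - 1)) ^ 2)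
      * Real.exp (2 * B) with hA
  have hA0 : 0 ≤ A := by positivity
  set M : ℕ := ⌈2 * A⌉₊ + 1 with hM
  set F : ℕ → ℝ := fun m => |Real.log ((g.eval ((m : ℤ) + 2)).natAbs : ℝ)
      - 2 * Real.log ((g.eval ((m : ℤ) + 1)).natAbs : ℝ) + Real.log ((g.eval (m : ℤ)).natAbs : ℝ)| with hF
  refine ⟨2 * A + ∑ k ∈ range M, F k * (k : ℝ) ^ 2, fun m hm => ?_⟩
  have hm0 : (0 : ℝ) < m := by exact_mod_cast hm
  have hS0 : 0 ≤ ∑ k ∈ range M, F k * (k : ℝ) ^ 2 := sum_nonneg fun k _ => by positivity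
  show F m ≤ _
  rcases Nat.lt_or_ge m M with hmM | hmM
  · -- small `m`: absorbed into the constant
    have h1 : F m * (m : ℝ) ^ 2 ≤ ∑ k ∈ range M, F k * (k : ℝ) ^ 2 :=
      single_le_sum (f := fun k => F k * (k : ℝ) ^ 2) (fun k _ => by positivity) (mem_range.mpr hmM)
    rw [le_div_iff₀ (by positivity)]
    nlinarith
  · -- large `m`: `|u - 1| ≤ A/m² ≤ 1/2`
    have hmA : 2 * A ≤ (m : ℝ) ^ 2 := by
      have h1 := Nat.le_ceil (2 * A)
      have h2 : ((⌈2 * A⌉₊ + 1 : ℕ) : ℝ) ≤ m := by exact_mod_cast hmM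
      push_cast at h2
      nlinarith
    -- the three values
    have hG1 : G (m + 1) = ((g.eval ((m : ℤ) + 1) : ℤ) : ℝ) := by simp only [hG]; push_cast; ring_nf
    have hG2 : G (m + 2) = ((g.eval ((m : ℤ) + 2) : ℤ) : ℝ) := by simp only [hG]; push_cast; ring_nf
    have hN0 : ((g.eval (m : ℤ)).natAbs : ℝ) = |G m| := hN m
    have hN1 : ((g.eval ((m : ℤ) + 1)).natAbs : ℝ) = |G (m + 1)| := by rw [← hN (m + 1)]; push_cast; ring_nf
    have hN2 : ((g.eval ((m : ℤ) + 2)).natAbs : ℝ) = |G (m + 2)| := by rw [← hN (m + 2)]; push_cast; ring_nf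
    set u : ℝ := G m * G (m + 2) / G (m + 1) ^ 2 with hu
    have hsq : 0 < G (m + 1) ^ 2 := by rw [← sq_abs]; exact pow_pos (hNpos _) 2
    have hlogu : Real.log ((g.eval ((m : ℤ) + 2)).natAbs : ℝ) - 2 * Real.log ((g.eval ((m : ℤ) + 1)).natAbs : ℝ)
        + Real.log ((g.eval (m : ℤ)).natAbs : ℝ) = Real.log |u| := by
      rw [hN0, hN1, hN2, hu, abs_div, abs_mul, abs_pow, Real.log_div (mul_ne_zero (hNpos m).ne' (hNpos _).ne')
        (pow_ne_zero _ (hNpos _).ne'), Real.log_mul (hNpos m).ne' (hNpos _).ne', Real.log_pow]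
      push_cast
      ring
    -- `u - 1 = (g(m) ∇²g - (∇g)²)/g(m+1)²`
    have hu1 : u - 1 = (G m * (G (m + 2) - 2 * G (m + 1) + G m) - (G (m + 1) - G m) ^ 2) / G (m + 1) ^ 2 := by
      rw [hu, div_sub_one hsq.ne']
      congr 1
      ring
    have hD2 : |G (m + 2) - 2 * G (m + 1) + G m| ≤ (d : ℝ) * d * L * 3 ^ (d - 2) * (m : ℝ) ^ (d - 2) := by
      have h1 := abs_eval_second_diff_le g m
      rw [← hd, ← hG1, ← hG2] at h1
      refine h1.trans ?_
      have h3 : ((m : ℝ) + 2) ^ (d - 2) ≤ (3 : ℝ) ^ (d - 2) * (m : ℝ) ^ (d - 2) := by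
        rw [← mul_pow]
        exact pow_le_pow_left₀ (by positivity) (by linarith [show (1 : ℝ) ≤ m by exact_mod_cast hm]) _
      have h4 : ((d - 1 : ℕ) : ℝ) ≤ d := by exact_mod_cast Nat.sub_le d 1
      calc (d : ℝ) * ((d - 1 : ℕ) : ℝ) * coeffAbsSum g * ((m : ℝ) + 2) ^ (d - 2)
          ≤ (d : ℝ) * d * L * ((3 : ℝ) ^ (d - 2) * (m : ℝ) ^ (d - 2)) := by
            rw [← hL]
            exact mul_le_mul (mul_le_mul_of_nonneg_right (mul_le_mul_of_nonneg_left h4 (Nat.cast_nonneg _))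
              hL0) h3 (by positivity) (by positivity)
        _ = _ := by ring
    have hD1 : |G (m + 1) - G m| ≤ (d : ℝ) * L * 2 ^ (d - 1) * (m : ℝ) ^ (d - 1) := by
      have h1 := abs_eval_succ_sub_eval_le g m
      rw [← hd, ← hG1] at h1
      refine h1.trans ?_
      have h3 : ((m : ℝ) + 1) ^ (d - 1) ≤ (2 : ℝ) ^ (d - 1) * (m : ℝ) ^ (d - 1) := by
        rw [← mul_pow]
        exact pow_le_pow_left₀ (by positivity) (by linarith [show (1 : ℝ) ≤ m by exact_mod_cast hm]) _
      calc (d : ℝ) * coeffAbsSum g * ((m : ℝ) + 1) ^ (d - 1) ≤ (d : ℝ) * L * ((2 : ℝ) ^ (d - 1) * (m : ℝ) ^ (d - 1)) :=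
            mul_le_mul_of_nonneg_left h3 (by positivity)
        _ = _ := by ring
    -- numerator `≤ A e^{-2B} m^{2d-2}`
    have hd2 : d - 2 + d = 2 * d - 2 := by omega
    have hd1 : (d - 1) + (d - 1) = 2 * d - 2 := by omega
    have hnum : |G m * (G (m + 2) - 2 * G (m + 1) + G m) - (G (m + 1) - G m) ^ 2|
        ≤ (Real.exp B * ((d : ℝ) * d * L * 3 ^ (d - 2)) + ((d : ℝ) * L * 2 ^ (d - 1)) ^ 2)
            * (m : ℝ) ^ (2 * d - 2) := by
      refine (abs_sub _ _).trans ?_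
      rw [abs_mul, abs_pow, add_mul]
      refine add_le_add ?_ ?_
      · calc |G m| * |G (m + 2) - 2 * G (m + 1) + G m|
            ≤ (Real.exp B * (m : ℝ) ^ d) * ((d : ℝ) * d * L * 3 ^ (d - 2) * (m : ℝ) ^ (d - 2)) :=
              mul_le_mul (hupp m hm) hD2 (abs_nonneg _) (by positivity)
          _ = Real.exp B * ((d : ℝ) * d * L * 3 ^ (d - 2)) * ((m : ℝ) ^ (d - 2) * (m : ℝ) ^ d) := by ring
          _ = _ := by rw [← pow_add, hd2]
      · calc |G (m + 1) - G m| ^ 2 ≤ ((d : ℝ) * L * 2 ^ (d - 1) * (m : ℝ) ^ (d - 1)) ^ 2 :=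
              pow_le_pow_left₀ (abs_nonneg _) hD1 2
          _ = ((d : ℝ) * L * 2 ^ (d - 1)) ^ 2 * ((m : ℝ) ^ (d - 1) * (m : ℝ) ^ (d - 1)) := by ring
          _ = _ := by rw [← pow_add, hd1]
    have hden : Real.exp (-(2 * B)) * (m : ℝ) ^ (2 * d) ≤ G (m + 1) ^ 2 := by
      have h1 := hlow (m + 1) (by omega)
      have h2 : Real.exp (-B) * (m : ℝ) ^ d ≤ Real.exp (-B) * ((m + 1 : ℕ) : ℝ) ^ d := by
        push_cast
        exact mul_le_mul_of_nonneg_left (pow_le_pow_left₀ hm0.le (by linarith) d) (Real.exp_pos _).le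
      have h3 : 0 ≤ Real.exp (-B) * (m : ℝ) ^ d := by positivity
      calc Real.exp (-(2 * B)) * (m : ℝ) ^ (2 * d) = (Real.exp (-B) * (m : ℝ) ^ d) ^ 2 := by
            rw [mul_pow, ← Real.exp_nat_mul, ← pow_mul]; push_cast; ring_nf
        _ ≤ |G (m + 1)| ^ 2 := pow_le_pow_left₀ h3 (h2.trans h1) 2
        _ = G (m + 1) ^ 2 := sq_abs _
    have hden0 : 0 < Real.exp (-(2 * B)) * (m : ℝ) ^ (2 * d) := by positivity
    have hu1le : |u - 1| ≤ A / (m : ℝ) ^ 2 := by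
      rw [hu1, abs_div, abs_of_pos hsq]
      calc |G m * (G (m + 2) - 2 * G (m + 1) + G m) - (G (m + 1) - G m) ^ 2| / G (m + 1) ^ 2
          ≤ (Real.exp B * ((d : ℝ) * d * L * 3 ^ (d - 2)) + ((d : ℝ) * L * 2 ^ (d - 1)) ^ 2)
              * (m : ℝ) ^ (2 * d - 2) / (Real.exp (-(2 * B)) * (m : ℝ) ^ (2 * d)) :=
            div_le_div₀ (by positivity) hnum hden0 hden
        _ = A / (m : ℝ) ^ 2 := by
            rw [hA, div_eq_div_iff hden0.ne' (by positivity), Real.exp_neg]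
            have hm2d : (m : ℝ) ^ (2 * d) = (m : ℝ) ^ (2 * d - 2) * (m : ℝ) ^ 2 := by
              rw [← pow_add]; congr 1; omega
            rw [hm2d]
            field_simp
    have hhalf : |u - 1| ≤ 1 / 2 := by
      refine hu1le.trans ?_
      rw [div_le_iff₀ (by positivity)]
      linarith
    have hune : u ≠ 0 := by
      intro h0
      rw [h0] at hhalf
      norm_num at hhalf
    rw [hF]
    simp only
    rw [hlogu, Real.log_abs]
    calc |Real.log u| ≤ 2 * |u - 1| := Literature.NumberTheory.Automorphic.abs_log_le_two_mul hhalf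
      _ ≤ 2 * (A / (m : ℝ) ^ 2) := by linarith
      _ = 2 * A / (m : ℝ) ^ 2 := by ring
      _ ≤ (2 * A + ∑ k ∈ range M, F k * (k : ℝ) ^ 2) / (m : ℝ) ^ 2 :=
          div_le_div_of_nonneg_right (by linarith) (by positivity)

/-! ### Where the located weight of the modulus `e` lives: `m ≍ e^{2/d}` -/

/-- **Lower support**: for `g` irreducible of degree `d ≥ 2` and `Δ > 0` there is `c > 0` with `a_e(m) = 0`
whenever `m ≥ 1` and `m^d ≤ c·e²`. [this work] -/
theorem exists_locWeight_eq_zero_of_pow_le {g : ℤ[X]} (hirr : Irreducible g) (hdeg : 2 ≤ g.natDegree)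
    {Δ : ℝ} (hΔ : 0 < Δ) :
    ∃ c : ℝ, 0 < c ∧ ∀ e m : ℕ, 1 ≤ m → (m : ℝ) ^ g.natDegree ≤ c * (e : ℝ) ^ 2 → locWeight g Δ e m = 0 := by
  obtain ⟨B, hB⟩ := exists_abs_log_natAbs_eval_sub_le (g := g) (by omega)
  have hz : ∀ k : ℕ, g.eval (k : ℤ) ≠ 0 := fun k => eval_natCast_ne_zero_of_irreducible hirr hdeg k
  refine ⟨Real.exp (-B) / (Real.exp Δ) ^ 2, by positivity, fun e m hm hle => ?_⟩
  have hm0 : (0 : ℝ) < m := by exact_mod_cast hm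
  have hNpos : (0 : ℝ) < ((g.eval (m : ℤ)).natAbs : ℝ) := by
    exact_mod_cast Nat.pos_of_ne_zero (Int.natAbs_ne_zero.mpr (hz m))
  have hupp : ((g.eval (m : ℤ)).natAbs : ℝ) ≤ Real.exp B * (m : ℝ) ^ g.natDegree := by
    have h1 := (abs_le.mp (hB m hm)).2
    calc ((g.eval (m : ℤ)).natAbs : ℝ) = Real.exp (Real.log ((g.eval (m : ℤ)).natAbs : ℝ)) :=
          (Real.exp_log hNpos).symm
      _ ≤ Real.exp (B + g.natDegree * Real.log m) := Real.exp_le_exp.mpr (by linarith)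
      _ = Real.exp B * (m : ℝ) ^ g.natDegree := by
          rw [Real.exp_add, ← Real.log_pow, Real.exp_log (pow_pos hm0 _)]
  refine locWeight_eq_zero g hΔ (hz m) ?_
  have hexp : 0 < (Real.exp Δ) ^ 2 := by positivity
  have h2 : Real.exp B * (m : ℝ) ^ g.natDegree * (Real.exp Δ) ^ 2 ≤ (e : ℝ) ^ 2 := by
    have h3 := mul_le_mul_of_nonneg_left hle (by positivity : (0 : ℝ) ≤ Real.exp B * (Real.exp Δ) ^ 2)
    calc Real.exp B * (m : ℝ) ^ g.natDegree * (Real.exp Δ) ^ 2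
        = Real.exp B * (Real.exp Δ) ^ 2 * (m : ℝ) ^ g.natDegree := by ring
      _ ≤ Real.exp B * (Real.exp Δ) ^ 2 * (Real.exp (-B) / (Real.exp Δ) ^ 2 * (e : ℝ) ^ 2) := h3
      _ = (Real.exp B * Real.exp (-B)) * (e : ℝ) ^ 2 := by field_simp
      _ = (e : ℝ) ^ 2 := by rw [← Real.exp_add, add_neg_cancel, Real.exp_zero, one_mul]
  exact (mul_le_mul_of_nonneg_right hupp hexp.le).trans h2

/-- **Upper support**: for `g` irreducible of degree `d ≥ 2` and `Δ > 0` there is `C` with `a_e(m) = 1`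
whenever `m, e ≥ 1` and `C·e² ≤ m^d`. [this work] -/
theorem exists_locWeight_eq_one_of_le_pow {g : ℤ[X]} (hirr : Irreducible g) (hdeg : 2 ≤ g.natDegree)
    {Δ : ℝ} (hΔ : 0 < Δ) :
    ∃ C : ℝ, 0 < C ∧ ∀ e m : ℕ, 1 ≤ e → 1 ≤ m → C * (e : ℝ) ^ 2 ≤ (m : ℝ) ^ g.natDegree →
      locWeight g Δ e m = 1 := by
  obtain ⟨B, hB⟩ := exists_abs_log_natAbs_eval_sub_le (g := g) (by omega)
  have hz : ∀ k : ℕ, g.eval (k : ℤ) ≠ 0 := fun k => eval_natCast_ne_zero_of_irreducible hirr hdeg k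
  refine ⟨Real.exp B * (Real.exp Δ) ^ 2, by positivity, fun e m he hm hle => ?_⟩
  have hm0 : (0 : ℝ) < m := by exact_mod_cast hm
  have hNpos : (0 : ℝ) < ((g.eval (m : ℤ)).natAbs : ℝ) := by
    exact_mod_cast Nat.pos_of_ne_zero (Int.natAbs_ne_zero.mpr (hz m))
  have hlow : Real.exp (-B) * (m : ℝ) ^ g.natDegree ≤ ((g.eval (m : ℤ)).natAbs : ℝ) := by
    have h1 := (abs_le.mp (hB m hm)).1
    calc Real.exp (-B) * (m : ℝ) ^ g.natDegree = Real.exp (-B + g.natDegree * Real.log m) := by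
          rw [Real.exp_add, ← Real.log_pow, Real.exp_log (pow_pos hm0 _)]
      _ ≤ Real.exp (Real.log ((g.eval (m : ℤ)).natAbs : ℝ)) := Real.exp_le_exp.mpr (by linarith)
      _ = ((g.eval (m : ℤ)).natAbs : ℝ) := Real.exp_log hNpos
  refine locWeight_eq_one g hΔ he (le_trans ?_ hlow)
  have := mul_le_mul_of_nonneg_left hle (Real.exp_pos (-B)).le
  rw [← mul_assoc, ← mul_assoc, show Real.exp (-B) * Real.exp B = 1 by
    rw [← Real.exp_add, neg_add_cancel, Real.exp_zero], one_mul] at this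
  rw [mul_pow, mul_comm]
  exact this

/-- **The weight of the modulus `e` vanishes at `m = 0` for `e ≥ e₀`** (`g(0) ≠ 0`). [this work] -/
theorem exists_locWeight_zero_eq_zero {g : ℤ[X]} (hirr : Irreducible g) (hdeg : 2 ≤ g.natDegree)
    {Δ : ℝ} (hΔ : 0 < Δ) : ∃ e₀ : ℕ, ∀ e : ℕ, e₀ ≤ e → locWeight g Δ e 0 = 0 := by
  have hz : g.eval ((0 : ℕ) : ℤ) ≠ 0 := eval_natCast_ne_zero_of_irreducible hirr hdeg 0
  set T : ℝ := ((g.eval ((0 : ℕ) : ℤ)).natAbs : ℝ) * (Real.exp Δ) ^ 2 with hT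
  refine ⟨⌈T⌉₊ + 1, fun e he => locWeight_eq_zero g hΔ hz ?_⟩
  have he1 : T + 1 ≤ e := by
    have h1 := Nat.le_ceil T
    have h2 : ((⌈T⌉₊ + 1 : ℕ) : ℝ) ≤ e := by exact_mod_cast he
    push_cast at h2
    linarith
  have hT0 : 0 ≤ T := by positivity
  rw [← hT]
  nlinarith

end Summit.Parity.BatemanHorn.Theorems
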